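import Mathlib
import Summits.Ventures.PercRepro.TriangleCapRegimes
import Summits.Ventures.PercRepro.TriangleCapTopEight
import Summits.Ventures.PercRepro.TriangleCapFifteenth

/-!
# PercRepro — THE TOP VALUES IN EXPLICIT `k`-REGIMES, II: the eighth and fifteenth values without the `min`
(p3, gen 50; part 225)

With `stabGapFull_ge_six` / `stabGapFull_ge_eight` of part 224 the `min` in the eighth and fifteenth values
disappears: for `2 a + 3 r ≤ k` the eighth-best value is `closed − 6 (r − 4)` (`cherry_eighth_best_of_k`) and the
top seven are the seven listed values (`cherry_top_seven_of_k`); for `2 a + 4 r ≤ k` and `4 ≤ a`, `15 ≤ r`, the top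
fourteen are the fourteen listed values (`cherry_top_fourteen_of_k`) and the fifteenth is `closed − 8 (r − 5)`
(`cherry_fifteenth_best_of_k`).  Axioms: standard.
-/

namespace PercRepro

namespace TriangleCap

namespace C047

open Finset

/-- **THE TOP SEVEN VALUES FOR `2 a + 3 r ≤ k`** (`3 ≤ a`, `10 ≤ r`). -/
theorem cherry_top_seven_of_k (k a r : ℕ) (ha3 : 3 ≤ a) (hr10 : 10 ≤ r) (hk : 2 * a + 3 * r ≤ k) :
    (∀ (D : SimpleGraph (Fin k)) [DecidableRel D.Adj], K4mFree D → D.edgeFinset.card + r = a * (k - a) →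
        D.edgeFinset.card * k < ∑ v, deg D v * deg D v + r * (k - 1 - r) + 6 * (r - 4) →
        ∃ g ∈ ({0, 2 * (r - 2), 2 * (r - 1), 4 * (r - 3), 4 * (r - 3) + 2, 4 * (r - 3) + 4,
          4 * (r - 3) + 6} : Finset ℕ),
          ∑ v, deg D v * deg D v + r * (k - 1 - r) + g = D.edgeFinset.card * k) ∧
      (∀ g ∈ ({0, 2 * (r - 2), 2 * (r - 1), 4 * (r - 3), 4 * (r - 3) + 2, 4 * (r - 3) + 4,
          4 * (r - 3) + 6} : Finset ℕ),
        ∃ (D : SimpleGraph (Fin k)) (_ : DecidableRel D.Adj), K4mFree D ∧ D.edgeFinset.card + r = a * (k - a) ∧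
          ∑ v, deg D v * deg D v + r * (k - 1 - r) + g = D.edgeFinset.card * k) :=
  cherry_top_seven k a r ha3 hr10 (by omega) (fun _ => by omega) (stabGapFull_ge_six k a r ha3 (by omega) hk)

/-- **THE EIGHTH-BEST VALUE IS `closed − 6 (r − 4)` FOR `2 a + 3 r ≤ k`** (`3 ≤ a`, `10 ≤ r`). -/
theorem cherry_eighth_best_of_k (k a r : ℕ) (ha3 : 3 ≤ a) (hr10 : 10 ≤ r) (hk : 2 * a + 3 * r ≤ k) :
    (∀ (D : SimpleGraph (Fin k)) [DecidableRel D.Adj], K4mFree D → D.edgeFinset.card + r = a * (k - a) →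
        (∀ g ∈ ({0, 2 * (r - 2), 2 * (r - 1), 4 * (r - 3), 4 * (r - 3) + 2, 4 * (r - 3) + 4,
          4 * (r - 3) + 6} : Finset ℕ), ∑ v, deg D v * deg D v + r * (k - 1 - r) + g ≠ D.edgeFinset.card * k) →
        ∑ v, deg D v * deg D v + r * (k - 1 - r) + 6 * (r - 4) ≤ D.edgeFinset.card * k) ∧
      ∃ (D : SimpleGraph (Fin k)) (_ : DecidableRel D.Adj), K4mFree D ∧ D.edgeFinset.card + r = a * (k - a) ∧
        ∑ v, deg D v * deg D v + r * (k - 1 - r) + 6 * (r - 4) = D.edgeFinset.card * k := by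
  have h := cherry_eighth_best k a r ha3 hr10 (by omega) (fun _ => by omega)
  rw [min_eq_left (stabGapFull_ge_six k a r ha3 (by omega) hk)] at h
  exact h

/-- **THE TOP FOURTEEN VALUES FOR `2 a + 4 r ≤ k`** (`4 ≤ a`, `15 ≤ r`). -/
theorem cherry_top_fourteen_of_k (k a r : ℕ) (ha4 : 4 ≤ a) (hr15 : 15 ≤ r) (hk : 2 * a + 4 * r ≤ k) :
    (∀ (D : SimpleGraph (Fin k)) [DecidableRel D.Adj], K4mFree D → D.edgeFinset.card + r = a * (k - a) →
        D.edgeFinset.card * k < ∑ v, deg D v * deg D v + r * (k - 1 - r) + 8 * (r - 5) →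
        ∃ g ∈ ({0, 2 * (r - 2), 2 * (r - 1), 4 * (r - 3), 4 * (r - 3) + 2, 4 * (r - 3) + 4, 4 * (r - 3) + 6,
          6 * (r - 4), 6 * (r - 4) + 2, 6 * (r - 4) + 4, 6 * (r - 4) + 6, 6 * (r - 4) + 8, 6 * (r - 4) + 10,
          6 * (r - 4) + 12} : Finset ℕ),
          ∑ v, deg D v * deg D v + r * (k - 1 - r) + g = D.edgeFinset.card * k) ∧
      (∀ g ∈ ({0, 2 * (r - 2), 2 * (r - 1), 4 * (r - 3), 4 * (r - 3) + 2, 4 * (r - 3) + 4, 4 * (r - 3) + 6,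
          6 * (r - 4), 6 * (r - 4) + 2, 6 * (r - 4) + 4, 6 * (r - 4) + 6, 6 * (r - 4) + 8, 6 * (r - 4) + 10,
          6 * (r - 4) + 12} : Finset ℕ),
        ∃ (D : SimpleGraph (Fin k)) (_ : DecidableRel D.Adj), K4mFree D ∧ D.edgeFinset.card + r = a * (k - a) ∧
          ∑ v, deg D v * deg D v + r * (k - 1 - r) + g = D.edgeFinset.card * k) :=
  cherry_top_fourteen k a r ha4 hr15 (by omega) (stabGapFull_ge_eight k a r (by omega) (by omega) hk)

/-- **THE FIFTEENTH-BEST VALUE IS `closed − 8 (r − 5)` FOR `2 a + 4 r ≤ k`** (`4 ≤ a`, `15 ≤ r`). -/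
theorem cherry_fifteenth_best_of_k (k a r : ℕ) (ha4 : 4 ≤ a) (hr15 : 15 ≤ r) (hk : 2 * a + 4 * r ≤ k) :
    (∀ (D : SimpleGraph (Fin k)) [DecidableRel D.Adj], K4mFree D → D.edgeFinset.card + r = a * (k - a) →
        (∀ g ∈ ({0, 2 * (r - 2), 2 * (r - 1), 4 * (r - 3), 4 * (r - 3) + 2, 4 * (r - 3) + 4, 4 * (r - 3) + 6,
          6 * (r - 4), 6 * (r - 4) + 2, 6 * (r - 4) + 4, 6 * (r - 4) + 6, 6 * (r - 4) + 8, 6 * (r - 4) + 10,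
          6 * (r - 4) + 12} : Finset ℕ), ∑ v, deg D v * deg D v + r * (k - 1 - r) + g ≠ D.edgeFinset.card * k) →
        ∑ v, deg D v * deg D v + r * (k - 1 - r) + 8 * (r - 5) ≤ D.edgeFinset.card * k) ∧
      ∃ (D : SimpleGraph (Fin k)) (_ : DecidableRel D.Adj), K4mFree D ∧ D.edgeFinset.card + r = a * (k - a) ∧
        ∑ v, deg D v * deg D v + r * (k - 1 - r) + 8 * (r - 5) = D.edgeFinset.card * k := by
  have h := cherry_fifteenth_best k a r ha4 hr15 (by omega)
  rw [min_eq_left (stabGapFull_ge_eight k a r (by omega) (by omega) hk)] at h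
  exact h

end C047

end TriangleCap

end PercRepro
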